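import Summits.QuantumFields.YangMills.Theorems.FlatTubeReductionProfileDressingPackageN
import Summits.QuantumFields.YangMills.Theorems.FlatTubeReductionRecordProfileNumbers
import Summits.QuantumFields.YangMills.Theorems.FlatTubeReductionNormalisedProfileR
import Summits.QuantumFields.YangMills.Theorems.LuscherReductionTwistedTraceScalingBTProfileRates
import HarnessLib

/-!
# THE PROFILE + DRESSING PACKAGE AT RADIUS `r_B` FOR THE RECORD PROFILE: `profileDressing_package_R` — the nineteen conjuncts of `…ProfileDressingPackageN.profileDressing_package_n`
# (normaliser `n_β`, exact fibre mass `γ_β`, dressing `W_β`, ratio `m̃_β`, slack `ε_β = O(λ_b²)`, `κ`) for `Ω₀ = recordProfile L`, lane A's cap-balanced stiff Gaussian profile supported in the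
# fibre ball of radius `r_B = min (1/40) (β^{-1/2}·btLog β)`
# (route `FlatTubeReduction`, crux K1 `NearFlatRatioLaw` stmt-QuantumFields-24720; seat `ym-line-ftr-p1` g17; rate twin «ratepack-v5»; R2b1 RECORD rung — no summit statement is proved here)

WHY (memo `Cruxes/NearFlatRatioLaw/Lines/ratepack-v5-nearpair-g16.md` §6 (P4)).  Same assembly as `profileDressing_package_n` (F8 exact dressing + F9 normalised profile + F8f dressed
weight of the quotient), fed by the radius-`r_B` inputs: `…RecordProfileNumbers.exactDressing_of_recordProfile` (the seven Gaussian profile numbers), `…NormalisedProfileR.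
normalisedProfile_package_R` (support hypothesis `R² ≤ β^{-3/4}`), and the three radius facts `recordRadius_eventually` (`0 < r_B`, `12|Site|·r_B < β^{-1/6}`, `r_B² ≤ β^{-3/4}`
eventually).  With `…DressedHTEventuallyR.dressed_hT_eventually_R` this closes the hN and hT fields of `RateTube.AnalyticRatePotInput` for the shared profile of record (next file).
* `recordRadius_eventually`, ★★★★ `profileDressing_package_R`; ★★★★ `profileDressing_package_Rpos` (appended) — the same plus the normaliser-positivity conjunct.
HONEST FRAMING: bookkeeping; hST and the hODpot-rate analysis remain; femto rung R2b1 (RECORD label); not infinite volume, not a gap, not Clay.  No defs, no named facts, no `sorry`.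
-/

set_option autoImplicit false

noncomputable section

open MeasureTheory Filter Topology Real
open scoped BigOperators
open Literature.MathematicalPhysics.QuantumFieldTheory
open Literature.MathematicalPhysics.QuantumLattice

namespace Summit.QuantumFields.YangMills.Theorems.FemtoTransferGap.RateTube

open Summit.QuantumFields.YangMills.Theorems.FemtoTransferGap
open Summit.QuantumFields.YangMills.Theorems.FemtoTransferGap.TwoLattice
open Summit.QuantumFields.YangMills.Theorems.FemtoTransferGap.TwoLattice.ConstTube
open Summit.QuantumFields.YangMills.Theorems.FemtoTransferGap.TwoLattice.Avg
open Summit.QuantumFields.YangMills.Theorems.FemtoTransferGap.TwoLattice.Stiff (LinkSpace)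

variable {L : ℕ} [NeZero L]

/-- ★ **The three radius facts of the record radius** `r_B = min (1/40) (powScale (1/2) β·btLog β)`: `0 < r_B` (every `β`), `12|Site|·r_B < β^{-1/6}` eventually, and
`r_B² ≤ β^{-3/4}` eventually (`r_B² ≤ β^{-1}log²β = β^{-3/4}·(β^{-1/4}log²β)`). [folklore] -/
theorem recordRadius_eventually :
    (∀ᶠ β : ℝ in atTop, 0 < min (1 / 40) (powScale (1 / 2) β * btLog β)) ∧
      (∀ᶠ β : ℝ in atTop, 12 * Fintype.card (Site 3 L) * min (1 / 40) (powScale (1 / 2) β * btLog β) < powScale (1 / 6) β) ∧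
      (∀ᶠ β : ℝ in atTop, (min (1 / 40) (powScale (1 / 2) β * btLog β)) ^ 2 ≤ powScale (3 / 4) β) := by
  have hpos : ∀ β : ℝ, 0 < powScale (1 / 2) β * btLog β := fun β => mul_pos (powScale_pos _ _) (lt_of_lt_of_le one_pos (one_le_btLog β))
  have hr : ∀ β : ℝ, 0 ≤ min (1 / 40) (powScale (1 / 2) β * btLog β) ∧ min (1 / 40) (powScale (1 / 2) β * btLog β) ≤ powScale (1 / 2) β * btLog β := fun β =>
    ⟨le_min (by norm_num) (hpos β).le, min_le_right _ _⟩
  refine ⟨Filter.Eventually.of_forall fun β => lt_min (by norm_num) (hpos β), eventually_radius_small_B (L := L) (by norm_num : (1 / 6 : ℝ) < 1 / 2) hr, ?_⟩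
  filter_upwards [(tendsto_powScale_mul_btLog_pow (p := 1 / 4) (by norm_num) 2).eventually (eventually_le_nhds one_pos)] with β hβ
  have h34 : 0 < powScale (3 / 4) β := powScale_pos _ _
  calc (min (1 / 40) (powScale (1 / 2) β * btLog β)) ^ 2 ≤ (powScale (1 / 2) β * btLog β) ^ 2 := pow_le_pow_left₀ (hr β).1 (hr β).2 2
    _ = powScale (3 / 4) β * (powScale (1 / 4) β * btLog β ^ 2) := by
        rw [mul_pow, powScale_half_sq', ← mul_assoc, powScale_mul_powScale]; norm_num
    _ ≤ powScale (3 / 4) β * 1 := mul_le_mul_of_nonneg_left hβ h34.le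
    _ = powScale (3 / 4) β := mul_one _

set_option maxHeartbeats 1600000 in
/-- ★★★★ **THE PROFILE + DRESSING PACKAGE OF THE RECORD PROFILE AT RADIUS `r_B`** (`L ≥ 2`, window constant `D ≥ 0`): there is `M₀ ≥ 2` and for every `M ≥ M₀` a normaliser `n_β`,
a ratio `m̃_β`, a dressing `W_β`, a mass `γ_β > 0`, a slack `ε_β = O(λ_b(L³β)²)` and `κ ≥ 0` with: the product profile `n_β(u)·recordProfile L β (x)` is jointly measurable, `|·| ≤ 1`,
gauge covariant and supported in `‖x‖ ≤ r_B = min (1/40) (powScale (1/2) β·btLog β)`; its fibre mass against `softWeight (recordChi L (1/6) (42D+1) M β)` is EXACTLY `γ_β` on the window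
(eventually); `W_β` physical, `0 ≤ W_β ≤ √(1+κ/4)`, `|W_β² − 1| ≤ κ·orbitDist²` on the window; and eventually on the window `|W_β² − f_β/f_β(1)/m̃_β| ≤ ε_β`, `|m̃_β − 1| ≤ κ·orbitDist² + ε_β`,
`0 < m̃_β`, `n_β²·m̃_β = ½`; `n_β` measurable, `0 ≤ n_β ≤ 1`, gauge invariant (the nineteen conjuncts of `profileDressing_package_n`, verbatim, for `Ω₀ = recordProfile L` at radius `r_B`).
[cite: Luscher1983, §3] -/
theorem profileDressing_package_R (hL2 : 2 ≤ L) (hL : Nonempty (NzSite L)) {D : ℝ} (hD : 0 ≤ D) :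
    ∃ M₀ : ℝ, 2 ≤ M₀ ∧ ∀ M : ℝ, M₀ ≤ M → ∃ (n m W : ℝ → GaugeConfig 3 1 SU2 → ℝ) (γ ε : ℝ → ℝ) (κ : ℝ), 0 ≤ κ ∧
      -- profile fields
      (∀ β, Measurable (Function.uncurry fun u x => n β u * (recordProfile L) β x)) ∧ (∀ β u x, |n β u * (recordProfile L) β x| ≤ 1) ∧
      (∀ β (g : SU2) (u : GaugeConfig 3 1 SU2) (v : LinkSpace L), n β (gaugeTransform (fun _ : Site 3 1 => g) u) * (recordProfile L) β (adL L g v) = n β u * (recordProfile L) β v) ∧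
      (∀ β u x, n β u * (recordProfile L) β x ≠ 0 → ‖x‖ ≤ min (1 / 40) (powScale (1 / 2) β * btLog β)) ∧
      -- exact fibre mass
      (∀ β, 0 < γ β) ∧
      (∀ᶠ β in atTop, ∀ u : GaugeConfig 3 1 SU2, orbitDist u < D * recordDelta1 L (1 / 6) β →
        fibreMassAd L (softWeight (recordChi L (1 / 6) (42 * D + 1) M β)) (fun u x => n β u * (recordProfile L) β x) u = γ β) ∧
      -- dressing fields
      (∀ β, IsPhys (W β)) ∧ (∀ β u, 0 ≤ W β u) ∧ (∀ β u, |W β u| ≤ Real.sqrt (1 + κ / 4)) ∧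
      (∀ β u, orbitDist u < D * recordDelta1 L (1 / 6) β → |W β u ^ 2 - 1| ≤ κ * orbitDist u ^ 2) ∧
      (∃ a' : ℝ, ∀ᶠ β in atTop, ε β ≤ a' * bareLambda ((L : ℝ) ^ 3 * β) ^ 2) ∧
      -- the window identities (eventually)
      (∀ᶠ β in atTop, ∀ u : GaugeConfig 3 1 SU2, orbitDist u < D * recordDelta1 L (1 / 6) β →
        |W β u ^ 2 - fpBOKernel L β ((recordProfile L) β) (fpWeight L β⁻¹) u u / transferKernel su2Rep ((L : ℝ) ^ 3 * β) u u /
            (fpBOKernel L β ((recordProfile L) β) (fpWeight L β⁻¹) 1 1 / transferKernel su2Rep ((L : ℝ) ^ 3 * β) (1 : GaugeConfig 3 1 SU2) 1) / m β u| ≤ ε β ∧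
        |m β u - 1| ≤ κ * orbitDist u ^ 2 + ε β ∧ 0 < m β u ∧ n β u ^ 2 * m β u = 1 / 2) ∧
      (∀ β, Measurable (n β)) ∧ (∀ β u, 0 ≤ n β u ∧ n β u ≤ 1) ∧ (∀ β (g : Site 3 1 → SU2) (u : GaugeConfig 3 1 SU2), n β (gaugeTransform g u) = n β u) := by
  obtain ⟨hΩm, hΩ01, hCΩ, hΩinv⟩ := recordProfile_fields L
  have hΩ0 : ∀ β x, 0 ≤ (recordProfile L) β x := fun β x => (hΩ01 β x).1
  -- F8-R: the exact dressing of the record profile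
  obtain ⟨κ₀, hκ₀, εW, ⟨a', hεWa⟩, hεW0, -, -, -, hWsq, hWnear⟩ := exactDressing_of_recordProfile (L := L) hL2 hD
  -- F9-R: the normalised profile at radius `r_B`
  obtain ⟨hR0, hRsmall, hR1⟩ := recordRadius_eventually (L := L)
  have hγ : ∀ᶠ β : ℝ in atTop, 0 < recordGamma L (recordProfile L) β := by
    filter_upwards [Filter.eventually_ge_atTop (0 : ℝ)] with β hβ using recordGamma_recordProfile_pos L hβ
  obtain ⟨M₀, hM₀, hpk⟩ := normalisedProfile_package_R hL hD hΩm hCΩ hΩinv (fun β x hx => norm_le_of_recordProfile_ne_zero L hx) hR0 hRsmall hR1 hγ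
  refine ⟨M₀, hM₀, fun M hM => ?_⟩
  obtain ⟨n, m, γ, κN, a, hκN, ha, hP1, hP2, hP3, hP4, hγpos, hN, hm_m, hm_g, hm_t, hmwin, hn_m, hn01, hn_g⟩ := hpk M hM
  -- the exact diagonal ratio family `f̂`
  obtain ⟨f, hfdef⟩ : ∃ f : ℝ → GaugeConfig 3 1 SU2 → ℝ, f = fun β u =>
      fpBOKernel L β ((recordProfile L) β) (fpWeight L β⁻¹) u u / transferKernel su2Rep ((L : ℝ) ^ 3 * β) u u /
        (fpBOKernel L β ((recordProfile L) β) (fpWeight L β⁻¹) 1 1 / transferKernel su2Rep ((L : ℝ) ^ 3 * β) (1 : GaugeConfig 3 1 SU2) 1) := ⟨_, rfl⟩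
  have hfβ : ∀ β, (fun u : GaugeConfig 3 1 SU2 => fpBOKernel L β ((recordProfile L) β) (fpWeight L β⁻¹) u u / transferKernel su2Rep ((L : ℝ) ^ 3 * β) u u /
      (fpBOKernel L β ((recordProfile L) β) (fpWeight L β⁻¹) 1 1 / transferKernel su2Rep ((L : ℝ) ^ 3 * β) (1 : GaugeConfig 3 1 SU2) 1)) = f β := fun β => by rw [hfdef]
  have hfu : ∀ β (u : GaugeConfig 3 1 SU2), fpBOKernel L β ((recordProfile L) β) (fpWeight L β⁻¹) u u / transferKernel su2Rep ((L : ℝ) ^ 3 * β) u u /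
      (fpBOKernel L β ((recordProfile L) β) (fpWeight L β⁻¹) 1 1 / transferKernel su2Rep ((L : ℝ) ^ 3 * β) (1 : GaugeConfig 3 1 SU2) 1) = f β u := fun β u => by rw [hfdef]
  have hfm : ∀ β, Measurable (f β) := fun β => by
    rw [← hfβ]; exact (measurable_diagRatio β (hΩm β) (hCΩ β) (measurable_fpWeight L _) (abs_fpWeight_le L _)).div_const _
  have hfg : ∀ β (g : Site 3 1 → SU2) (u : GaugeConfig 3 1 SU2), f β (gaugeTransform g u) = f β u := fun β g u => by
    simp only [hfdef, diagRatio_gaugeTransform β (hΩm β) (hΩinv β) (measurable_fpWeight L _) (fun c g => fpWeight_conj _ c g) g u]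
  have hft : ∀ β (k : Fin 3), ∀ z ∈ Subgroup.center SU2, ∀ u : GaugeConfig 3 1 SU2, f β (twist k z u) = f β u := fun β k z hz u => by
    simp only [hfdef, diagRatio_twist β ((recordProfile L) β) (fpWeight L _) k hz u]
  have hf0 : ∀ β u, 0 ≤ f β u := fun β u => by
    simp only [hfdef]
    exact div_nonneg (diagRatio_nonneg β (hΩm β) (hCΩ β) (hΩ0 β) (measurable_fpWeight L _) (abs_fpWeight_le L _) (fun g => (fpWeight_mem_Icc L _ g).1) u)
      (diagRatio_nonneg β (hΩm β) (hCΩ β) (hΩ0 β) (measurable_fpWeight L _) (abs_fpWeight_le L _) (fun g => (fpWeight_mem_Icc L _ g).1) 1)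
  -- the window radius and the smallness facts
  have hδt : Tendsto (fun β => D * recordDelta1 L (1 / 6) β) atTop (𝓝 0) := by
    simpa using (tendsto_recordDelta1 (L := L) (by norm_num : (0 : ℝ) < 1 / 6)).const_mul D
  have hδ : ∀ᶠ β in atTop, D * recordDelta1 L (1 / 6) β ≤ 1 / 2 := hδt.eventually (eventually_le_nhds (by norm_num))
  have hεN0 : ∀ᶠ β : ℝ in atTop, 0 ≤ a * bareLambda ((L : ℝ) ^ 3 * β) ^ 2 := Filter.Eventually.of_forall fun β => mul_nonneg ha (sq_nonneg _)
  have hsmall : ∀ᶠ β in atTop, κN * (D * recordDelta1 L (1 / 6) β) ^ 2 + a * bareLambda ((L : ℝ) ^ 3 * β) ^ 2 ≤ 1 / 2 := by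
    filter_upwards [hδ, eventually_mul_le_of_tendsto hδt κN (by norm_num : (0:ℝ) < 1 / 4), mul_bareLambda_sq_eventually_le (L := L) ha] with β h1 h2 h3
    have h0 : 0 ≤ D * recordDelta1 L (1 / 6) β := mul_nonneg hD (by unfold recordDelta1; have := card_site_pos (L := L); have := powScale_pos (1 / 6) β; positivity)
    nlinarith
  -- F8's near-`1` estimate for `f̂` itself (clamp ± its slack)
  have hnear : ∀ᶠ β in atTop, ∀ u : GaugeConfig 3 1 SU2, orbitDist u < D * recordDelta1 L (1 / 6) β → 0 ≤ f β u ∧ |f β u - 1| ≤ κ₀ * orbitDist u ^ 2 + εW β := by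
    filter_upwards [hWnear] with β hWn u hu
    refine ⟨hf0 β u, ?_⟩
    have h1 := hWsq β u hu
    have h2 := hWn u hu
    rw [hfβ β] at h1
    rw [hfβ β, hfu β u] at h2
    have e : f β u - 1 = (clampW κ₀ (f β) (fun U : GaugeConfig 3 1 SU2 => min (torDist U) (1 / 2)) u ^ 2 - 1) -
        (clampW κ₀ (f β) (fun U : GaugeConfig 3 1 SU2 => min (torDist U) (1 / 2)) u ^ 2 - f β u) := by ring
    rw [e]
    exact (abs_sub _ _).trans (by linarith)
  have hmnear : ∀ᶠ β in atTop, ∀ u : GaugeConfig 3 1 SU2, orbitDist u < D * recordDelta1 L (1 / 6) β → |m β u - 1| ≤ κN * orbitDist u ^ 2 + a * bareLambda ((L : ℝ) ^ 3 * β) ^ 2 := by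
    filter_upwards [hmwin] with β h u hu using (h u hu).1
  -- F8f: the dressed weight of the quotient
  obtain ⟨hphys, hW0, hWb, hWsq', hWn'⟩ := dressedWeight_fields_normalised (f := f) (m := m) hfm hfg hft hm_m hm_g hm_t
    (δ₁ := fun β => D * recordDelta1 L (1 / 6) β) (εW := εW) (εN := fun β => a * bareLambda ((L : ℝ) ^ 3 * β) ^ 2) (κ₀ := κ₀) (κN := κN) (κ := 2 * (κ₀ + κN))
    le_rfl (by positivity) hκN hδ hεW0 hεN0 hsmall hnear hmnear
  refine ⟨n, m, fun β => clampW (2 * (κ₀ + κN)) (fun u => f β u / m β u) (fun U : GaugeConfig 3 1 SU2 => min (torDist U) (1 / 2)), γ,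
    fun β => 2 * (εW β + a * bareLambda ((L : ℝ) ^ 3 * β) ^ 2), 2 * (κ₀ + κN), by positivity, hP1, hP2, hP3, hP4, hγpos, hN, hphys, hW0, hWb, hWsq',
    ⟨2 * a' + 2 * a, ?_⟩, ?_, hn_m, hn01, hn_g⟩
  · filter_upwards [hεWa] with β h
    nlinarith [sq_nonneg (bareLambda ((L : ℝ) ^ 3 * β))]
  · filter_upwards [hWn', hmwin, hεW0] with β hW hmw hε0 u hu
    obtain ⟨hm1, hm0, hnm⟩ := hmw u hu
    refine ⟨?_, ?_, hm0, hnm⟩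
    · rw [hfu β u]; exact hW u hu
    · have hsq := sq_nonneg (bareLambda ((L : ℝ) ^ 3 * β))
      have hd := sq_nonneg (orbitDist u)
      nlinarith [hm1, mul_nonneg hκ₀ hd, mul_nonneg ha hsq]

set_option maxHeartbeats 1600000 in
/-- ★★★★ **THE PROFILE + DRESSING PACKAGE OF THE RECORD PROFILE AT RADIUS `r_B`, normaliser POSITIVITY exported**: `profileDressing_package_R` verbatim plus one conjunct,
`0 < fibreMass (softWeight (recordChi L (1/6) (42D+1) M β)) (recordProfile L β) u → 0 < n_β u` for every `β, u` (the normaliser vanishes only on fibres of zero mass — the hypothesis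
under which fibre-orthogonality to `n_β·Ω₀_β` transfers to `Ω₀_β`, as the (B-ST) port needs). [cite: Luscher1983, §3] -/
theorem profileDressing_package_Rpos (hL2 : 2 ≤ L) (hL : Nonempty (NzSite L)) {D : ℝ} (hD : 0 ≤ D) :
    ∃ M₀ : ℝ, 2 ≤ M₀ ∧ ∀ M : ℝ, M₀ ≤ M → ∃ (n m W : ℝ → GaugeConfig 3 1 SU2 → ℝ) (γ ε : ℝ → ℝ) (κ : ℝ), 0 ≤ κ ∧
      -- profile fields
      (∀ β, Measurable (Function.uncurry fun u x => n β u * (recordProfile L) β x)) ∧ (∀ β u x, |n β u * (recordProfile L) β x| ≤ 1) ∧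
      (∀ β (g : SU2) (u : GaugeConfig 3 1 SU2) (v : LinkSpace L), n β (gaugeTransform (fun _ : Site 3 1 => g) u) * (recordProfile L) β (adL L g v) = n β u * (recordProfile L) β v) ∧
      (∀ β u x, n β u * (recordProfile L) β x ≠ 0 → ‖x‖ ≤ min (1 / 40) (powScale (1 / 2) β * btLog β)) ∧
      -- exact fibre mass
      (∀ β, 0 < γ β) ∧
      (∀ᶠ β in atTop, ∀ u : GaugeConfig 3 1 SU2, orbitDist u < D * recordDelta1 L (1 / 6) β →
        fibreMassAd L (softWeight (recordChi L (1 / 6) (42 * D + 1) M β)) (fun u x => n β u * (recordProfile L) β x) u = γ β) ∧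
      -- dressing fields
      (∀ β, IsPhys (W β)) ∧ (∀ β u, 0 ≤ W β u) ∧ (∀ β u, |W β u| ≤ Real.sqrt (1 + κ / 4)) ∧
      (∀ β u, orbitDist u < D * recordDelta1 L (1 / 6) β → |W β u ^ 2 - 1| ≤ κ * orbitDist u ^ 2) ∧
      (∃ a' : ℝ, ∀ᶠ β in atTop, ε β ≤ a' * bareLambda ((L : ℝ) ^ 3 * β) ^ 2) ∧
      -- the window identities (eventually)
      (∀ᶠ β in atTop, ∀ u : GaugeConfig 3 1 SU2, orbitDist u < D * recordDelta1 L (1 / 6) β →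
        |W β u ^ 2 - fpBOKernel L β ((recordProfile L) β) (fpWeight L β⁻¹) u u / transferKernel su2Rep ((L : ℝ) ^ 3 * β) u u /
            (fpBOKernel L β ((recordProfile L) β) (fpWeight L β⁻¹) 1 1 / transferKernel su2Rep ((L : ℝ) ^ 3 * β) (1 : GaugeConfig 3 1 SU2) 1) / m β u| ≤ ε β ∧
        |m β u - 1| ≤ κ * orbitDist u ^ 2 + ε β ∧ 0 < m β u ∧ n β u ^ 2 * m β u = 1 / 2) ∧
      (∀ β, Measurable (n β)) ∧ (∀ β u, 0 ≤ n β u ∧ n β u ≤ 1) ∧ (∀ β (g : Site 3 1 → SU2) (u : GaugeConfig 3 1 SU2), n β (gaugeTransform g u) = n β u) ∧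
      (∀ β u, 0 < fibreMass L (softWeight (recordChi L (1 / 6) (42 * D + 1) M β)) ((recordProfile L) β) u → 0 < n β u) := by
  obtain ⟨hΩm, hΩ01, hCΩ, hΩinv⟩ := recordProfile_fields L
  have hΩ0 : ∀ β x, 0 ≤ (recordProfile L) β x := fun β x => (hΩ01 β x).1
  -- F8-R: the exact dressing of the record profile
  obtain ⟨κ₀, hκ₀, εW, ⟨a', hεWa⟩, hεW0, -, -, -, hWsq, hWnear⟩ := exactDressing_of_recordProfile (L := L) hL2 hD
  -- F9-R: the normalised profile at radius `r_B`
  obtain ⟨hR0, hRsmall, hR1⟩ := recordRadius_eventually (L := L)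
  have hγ : ∀ᶠ β : ℝ in atTop, 0 < recordGamma L (recordProfile L) β := by
    filter_upwards [Filter.eventually_ge_atTop (0 : ℝ)] with β hβ using recordGamma_recordProfile_pos L hβ
  obtain ⟨M₀, hM₀, hpk⟩ := normalisedProfile_package_Rpos hL hD hΩm hCΩ hΩinv (fun β x hx => norm_le_of_recordProfile_ne_zero L hx) hR0 hRsmall hR1 hγ
  refine ⟨M₀, hM₀, fun M hM => ?_⟩
  obtain ⟨n, m, γ, κN, a, hκN, ha, hP1, hP2, hP3, hP4, hγpos, hN, hm_m, hm_g, hm_t, hmwin, hn_m, hn01, hn_g, hnpos⟩ := hpk M hM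
  -- the exact diagonal ratio family `f̂`
  obtain ⟨f, hfdef⟩ : ∃ f : ℝ → GaugeConfig 3 1 SU2 → ℝ, f = fun β u =>
      fpBOKernel L β ((recordProfile L) β) (fpWeight L β⁻¹) u u / transferKernel su2Rep ((L : ℝ) ^ 3 * β) u u /
        (fpBOKernel L β ((recordProfile L) β) (fpWeight L β⁻¹) 1 1 / transferKernel su2Rep ((L : ℝ) ^ 3 * β) (1 : GaugeConfig 3 1 SU2) 1) := ⟨_, rfl⟩
  have hfβ : ∀ β, (fun u : GaugeConfig 3 1 SU2 => fpBOKernel L β ((recordProfile L) β) (fpWeight L β⁻¹) u u / transferKernel su2Rep ((L : ℝ) ^ 3 * β) u u /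
      (fpBOKernel L β ((recordProfile L) β) (fpWeight L β⁻¹) 1 1 / transferKernel su2Rep ((L : ℝ) ^ 3 * β) (1 : GaugeConfig 3 1 SU2) 1)) = f β := fun β => by rw [hfdef]
  have hfu : ∀ β (u : GaugeConfig 3 1 SU2), fpBOKernel L β ((recordProfile L) β) (fpWeight L β⁻¹) u u / transferKernel su2Rep ((L : ℝ) ^ 3 * β) u u /
      (fpBOKernel L β ((recordProfile L) β) (fpWeight L β⁻¹) 1 1 / transferKernel su2Rep ((L : ℝ) ^ 3 * β) (1 : GaugeConfig 3 1 SU2) 1) = f β u := fun β u => by rw [hfdef]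
  have hfm : ∀ β, Measurable (f β) := fun β => by
    rw [← hfβ]; exact (measurable_diagRatio β (hΩm β) (hCΩ β) (measurable_fpWeight L _) (abs_fpWeight_le L _)).div_const _
  have hfg : ∀ β (g : Site 3 1 → SU2) (u : GaugeConfig 3 1 SU2), f β (gaugeTransform g u) = f β u := fun β g u => by
    simp only [hfdef, diagRatio_gaugeTransform β (hΩm β) (hΩinv β) (measurable_fpWeight L _) (fun c g => fpWeight_conj _ c g) g u]
  have hft : ∀ β (k : Fin 3), ∀ z ∈ Subgroup.center SU2, ∀ u : GaugeConfig 3 1 SU2, f β (twist k z u) = f β u := fun β k z hz u => by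
    simp only [hfdef, diagRatio_twist β ((recordProfile L) β) (fpWeight L _) k hz u]
  have hf0 : ∀ β u, 0 ≤ f β u := fun β u => by
    simp only [hfdef]
    exact div_nonneg (diagRatio_nonneg β (hΩm β) (hCΩ β) (hΩ0 β) (measurable_fpWeight L _) (abs_fpWeight_le L _) (fun g => (fpWeight_mem_Icc L _ g).1) u)
      (diagRatio_nonneg β (hΩm β) (hCΩ β) (hΩ0 β) (measurable_fpWeight L _) (abs_fpWeight_le L _) (fun g => (fpWeight_mem_Icc L _ g).1) 1)
  -- the window radius and the smallness facts
  have hδt : Tendsto (fun β => D * recordDelta1 L (1 / 6) β) atTop (𝓝 0) := by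
    simpa using (tendsto_recordDelta1 (L := L) (by norm_num : (0 : ℝ) < 1 / 6)).const_mul D
  have hδ : ∀ᶠ β in atTop, D * recordDelta1 L (1 / 6) β ≤ 1 / 2 := hδt.eventually (eventually_le_nhds (by norm_num))
  have hεN0 : ∀ᶠ β : ℝ in atTop, 0 ≤ a * bareLambda ((L : ℝ) ^ 3 * β) ^ 2 := Filter.Eventually.of_forall fun β => mul_nonneg ha (sq_nonneg _)
  have hsmall : ∀ᶠ β in atTop, κN * (D * recordDelta1 L (1 / 6) β) ^ 2 + a * bareLambda ((L : ℝ) ^ 3 * β) ^ 2 ≤ 1 / 2 := by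
    filter_upwards [hδ, eventually_mul_le_of_tendsto hδt κN (by norm_num : (0:ℝ) < 1 / 4), mul_bareLambda_sq_eventually_le (L := L) ha] with β h1 h2 h3
    have h0 : 0 ≤ D * recordDelta1 L (1 / 6) β := mul_nonneg hD (by unfold recordDelta1; have := card_site_pos (L := L); have := powScale_pos (1 / 6) β; positivity)
    nlinarith
  -- F8's near-`1` estimate for `f̂` itself (clamp ± its slack)
  have hnear : ∀ᶠ β in atTop, ∀ u : GaugeConfig 3 1 SU2, orbitDist u < D * recordDelta1 L (1 / 6) β → 0 ≤ f β u ∧ |f β u - 1| ≤ κ₀ * orbitDist u ^ 2 + εW β := by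
    filter_upwards [hWnear] with β hWn u hu
    refine ⟨hf0 β u, ?_⟩
    have h1 := hWsq β u hu
    have h2 := hWn u hu
    rw [hfβ β] at h1
    rw [hfβ β, hfu β u] at h2
    have e : f β u - 1 = (clampW κ₀ (f β) (fun U : GaugeConfig 3 1 SU2 => min (torDist U) (1 / 2)) u ^ 2 - 1) -
        (clampW κ₀ (f β) (fun U : GaugeConfig 3 1 SU2 => min (torDist U) (1 / 2)) u ^ 2 - f β u) := by ring
    rw [e]
    exact (abs_sub _ _).trans (by linarith)
  have hmnear : ∀ᶠ β in atTop, ∀ u : GaugeConfig 3 1 SU2, orbitDist u < D * recordDelta1 L (1 / 6) β → |m β u - 1| ≤ κN * orbitDist u ^ 2 + a * bareLambda ((L : ℝ) ^ 3 * β) ^ 2 := by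
    filter_upwards [hmwin] with β h u hu using (h u hu).1
  -- F8f: the dressed weight of the quotient
  obtain ⟨hphys, hW0, hWb, hWsq', hWn'⟩ := dressedWeight_fields_normalised (f := f) (m := m) hfm hfg hft hm_m hm_g hm_t
    (δ₁ := fun β => D * recordDelta1 L (1 / 6) β) (εW := εW) (εN := fun β => a * bareLambda ((L : ℝ) ^ 3 * β) ^ 2) (κ₀ := κ₀) (κN := κN) (κ := 2 * (κ₀ + κN))
    le_rfl (by positivity) hκN hδ hεW0 hεN0 hsmall hnear hmnear
  refine ⟨n, m, fun β => clampW (2 * (κ₀ + κN)) (fun u => f β u / m β u) (fun U : GaugeConfig 3 1 SU2 => min (torDist U) (1 / 2)), γ,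
    fun β => 2 * (εW β + a * bareLambda ((L : ℝ) ^ 3 * β) ^ 2), 2 * (κ₀ + κN), by positivity, hP1, hP2, hP3, hP4, hγpos, hN, hphys, hW0, hWb, hWsq',
    ⟨2 * a' + 2 * a, ?_⟩, ?_, hn_m, hn01, hn_g, hnpos⟩
  · filter_upwards [hεWa] with β h
    nlinarith [sq_nonneg (bareLambda ((L : ℝ) ^ 3 * β))]
  · filter_upwards [hWn', hmwin, hεW0] with β hW hmw hε0 u hu
    obtain ⟨hm1, hm0, hnm⟩ := hmw u hu
    refine ⟨?_, ?_, hm0, hnm⟩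
    · rw [hfu β u]; exact hW u hu
    · have hsq := sq_nonneg (bareLambda ((L : ℝ) ^ 3 * β))
      have hd := sq_nonneg (orbitDist u)
      nlinarith [hm1, mul_nonneg hκ₀ hd, mul_nonneg ha hsq]


end Summit.QuantumFields.YangMills.Theorems.FemtoTransferGap.RateTube

end
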